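import Mathlib.Combinatorics.SimpleGraph.Coloring.Vertex
import Mathlib.Data.List.GetD
import HarnessLib

/-!
# A polynomial 2-colouring scan on adjacency codes (the transducer of `#BIS ≤_AP #DOWNSETS`)

Support file for the discharge of `DyerEtAl2003.BISAPReducibleDownsets` (`BISDownsets.lean`:
Dyer–Goldberg–Greenhill–Jerrum 2003, Theorem 5, direction `#BIS ≤_AP #DOWNSETS`). The reduction is
parsimonious — a bipartite graph with side `A` is the height-two order `i ≻ j ⇔ i ∉ A, j ∈ A, ij ∈ E`
(`bisCount_encode_eq_downsetCount`, proved there) — but the transducer has to FIND a side `A` of the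
graph it is given by its code, in polynomial time, and to recognise non-bipartite graphs (on which
`bisCount` is `0`). This file is the mathematics of that transducer, written as a first-order
functional program on lists of naturals so that `TwoColouringScanFP.lean` can run it on codes with
the typed `FP` algebra `CodeFP`:

* the graph READ OFF a size `n` and a bit string `v` (row-major adjacency bits, symmetrised, loops
  removed — exactly how `encodingGraph` decodes): `TwoColouring.bit`, `TwoColouring.adj`,
  `TwoColouring.graph` (`graph_adj`);
* colour lists `c : List ℕ` read by `col c i = c.getD i 0` with colours `0`, `1` and blank `2`;
  one PROPAGATION round `propagate` (a blank vertex with a `0`-neighbour becomes `1`, else with a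
  `1`-neighbour becomes `0`), its `n`-fold iterate `close`, the SEEDING `seed s` (a blank `s`
  becomes `0`), and the scan `colouring n v = foldl (fun c s => close (seed s c)) blank [0, …, n)`;
* the test `proper` ("every edge has exactly one end of colour `0`") and the implication-matrix
  `entries` of the height-two order with side `{colour 0}`;
* the size facts the accumulator bounds of the folds consume (`mem_propagate`, `mem_seed`,
  `mem_iterate_propagate`, `SizeInv`, `sizeInv_foldl`: colour lists keep `n` items of value `≤ 2`,
  or values of the initial list).

The correctness of the scan (a 2-colourable graph gets a proper colouring) is
`TwoColouringScanCorrect.lean`. Breadth-first 2-colouring is textbook (e.g. J. Kleinberg, É. Tardos,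
*Algorithm Design*, 2005, §3.4); the scan here trades the queue for `n²` oblivious rounds, which
keeps the program a composition of maps and bounded folds.

## References

* M. Dyer, L. A. Goldberg, C. Greenhill, M. Jerrum, *The relative complexity of approximate counting
  problems*, Algorithmica 38 (2003) 471–500, Theorem 5 [DyerEtAl2003].
* S. Arora, B. Barak, *Computational Complexity: A Modern Approach*, CUP 2009, §1.3 (polynomial time
  is closed under composition and bounded loops) [AroraBarak2009].
-/

namespace Literature.Computability.Complexity

namespace TwoColouring

/-! ### The graph read off a size and a bit string -/

/-- Bit `k` of the string `v` (`false` past the end). [folklore] -/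
def bit (v : List Bool) (k : ℕ) : Bool := v.getD k false

/-- Adjacency of the graph coded by `(n, v)`: vertices `i ≠ j` with bit `(i, j)` or bit `(j, i)` set
(row-major index `j + n i`, as `finProdFinEquiv`). [folklore] -/
def adj (n : ℕ) (v : List Bool) (i j : ℕ) : Bool :=
  !(i == j) && (bit v (j + n * i) || bit v (i + n * j))

/-- The graph on `Fin n` coded by `(n, v)` (the value of `encodingGraph.decode` on a well-formed
code, see `BISDownsetsProofs.lean`). [folklore] -/
def graph (n : ℕ) (v : List Bool) : SimpleGraph (Fin n) :=
  SimpleGraph.fromRel fun i j : Fin n => bit v (j.val + n * i.val) = true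

/-- Adjacency is symmetric. [folklore] -/
theorem adj_comm (n : ℕ) (v : List Bool) (i j : ℕ) : adj n v i j = adj n v j i := by
  unfold adj
  rw [Bool.or_comm]
  cases hij : (i == j) <;> cases hji : (j == i) <;> simp_all

/-- Adjacency is loop-free. [folklore] -/
theorem adj_self (n : ℕ) (v : List Bool) (i : ℕ) : adj n v i i = false := by
  simp [adj]

/-- Adjacency in `graph n v` is `adj n v` on the vertex numbers. [folklore] -/
theorem graph_adj (n : ℕ) (v : List Bool) (i j : Fin n) :
    (graph n v).Adj i j ↔ adj n v i.val j.val = true := by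
  rw [graph, SimpleGraph.fromRel_adj, adj]
  simp only [Bool.and_eq_true, Bool.not_eq_true', beq_eq_false_iff_ne, ne_eq, Bool.or_eq_true,
    Fin.ext_iff]

/-- Adjacency of `graph n v` is decidable (through `graph_adj`). [folklore] -/
instance (n : ℕ) (v : List Bool) : DecidableRel (graph n v).Adj := fun i j =>
  decidable_of_iff _ (graph_adj n v i j).symm

/-! ### Colour lists and the scan -/

/-- Colour of vertex `i` in the colour list `c` (`0` past the end); colours are `0`, `1`, blank is
`2`. [folklore] -/
def col (c : List ℕ) (i : ℕ) : ℕ := c.getD i 0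

/-- Vertex `i` has a neighbour of colour `a`. [folklore] -/
def hasNbr (n : ℕ) (v : List Bool) (c : List ℕ) (i a : ℕ) : Bool :=
  (List.range n).any fun j => adj n v i j && (col c j == a)

/-- The new colour of vertex `i` after one propagation round: a blank vertex with a `0`-neighbour
becomes `1`, else with a `1`-neighbour becomes `0`, else stays blank; coloured vertices keep their
colour. [folklore] -/
def recolour (n : ℕ) (v : List Bool) (c : List ℕ) (i : ℕ) : ℕ :=
  if col c i == 2 then (if hasNbr n v c i 0 then 1 else if hasNbr n v c i 1 then 0 else 2)
  else col c i

/-- One propagation round. [folklore] -/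
def propagate (n : ℕ) (v : List Bool) (c : List ℕ) : List ℕ :=
  (List.range n).map (recolour n v c)

/-- `n` propagation rounds (a fold over a budget of `n` units). [folklore] -/
def close (n : ℕ) (v : List Bool) (c : List ℕ) : List ℕ :=
  (List.replicate n ()).foldl (fun c _ => propagate n v c) c

/-- Seeding: a blank vertex `s` gets colour `0`. [folklore] -/
def seed (n s : ℕ) (c : List ℕ) : List ℕ :=
  (List.range n).map fun i => if (i == s) && (col c i == 2) then 0 else col c i

/-- The blank colouring. [folklore] -/
def blank (n : ℕ) : List ℕ := (List.range n).map fun _ => 2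

/-- **The scan**: seed `0, 1, …, n - 1` in turn, closing under propagation after each seed.
[folklore] -/
def colouring (n : ℕ) (v : List Bool) : List ℕ :=
  (List.range n).foldl (fun c s => close n v (seed n s c)) (blank n)

/-- The test "every edge has exactly one end of colour `0`". [folklore] -/
def proper (n : ℕ) (v : List Bool) (c : List ℕ) : Bool :=
  (List.range n).all fun i => (List.range n).all fun j =>
    !(adj n v i j) || !((col c i == 0) == (col c j == 0))

/-- Entry `(i, j)` of the implication matrix of the height-two order with side `{colour 0}`:
`1` iff `i` is not of colour `0`, `j` is, and `ij` is an edge. [folklore] -/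
def entry (n : ℕ) (v : List Bool) (c : List ℕ) (i j : ℕ) : ℕ :=
  if !(col c i == 0) && ((col c j == 0) && adj n v i j) then 1 else 0

/-- The implication matrix, row-major. [folklore] -/
def entries (n : ℕ) (v : List Bool) (c : List ℕ) : List ℕ :=
  ((List.range n).map fun i => (List.range n).map fun j => entry n v c i j).flatten

/-! ### Reading the lists -/

/-- Reading a tabulated list. [folklore] -/
theorem col_map_range {n i : ℕ} (f : ℕ → ℕ) (hi : i < n) : col ((List.range n).map f) i = f i := by
  rw [col, List.getD_eq_getElem _ _ (by simpa using hi)]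
  simp

/-- Every vertex of the blank colouring is blank. [folklore] -/
theorem col_blank {n i : ℕ} (hi : i < n) : col (blank n) i = 2 := col_map_range _ hi

/-- Reading a propagated list: `recolour`. [folklore] -/
theorem col_propagate {n i : ℕ} (v : List Bool) (c : List ℕ) (hi : i < n) :
    col (propagate n v c) i = recolour n v c i := col_map_range _ hi

/-- Reading a seeded list. [folklore] -/
theorem col_seed {n s i : ℕ} (c : List ℕ) (hi : i < n) :
    col (seed n s c) i = if (i == s) && (col c i == 2) then 0 else col c i := col_map_range _ hi

/-- A propagated list has `n` items. [folklore] -/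
theorem length_propagate (n : ℕ) (v : List Bool) (c : List ℕ) : (propagate n v c).length = n := by
  simp [propagate]

/-- A seeded list has `n` items. [folklore] -/
theorem length_seed (n s : ℕ) (c : List ℕ) : (seed n s c).length = n := by simp [seed]

/-- The blank list has `n` items. [folklore] -/
theorem length_blank (n : ℕ) : (blank n).length = n := by simp [blank]

/-- A fold over a budget of units is an iterate. [folklore] -/
theorem foldl_replicate_unit {α : Type} (f : α → α) (k : ℕ) (a : α) :
    (List.replicate k ()).foldl (fun a _ => f a) a = f^[k] a := by
  induction k generalizing a with
  | zero => rfl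
  | succ k ih => rw [List.replicate_succ, List.foldl_cons, ih, Function.iterate_succ_apply]

/-- `close` is the `n`-th iterate of `propagate`. [folklore] -/
theorem close_eq_iterate (n : ℕ) (v : List Bool) (c : List ℕ) : close n v c = (propagate n v)^[n] c :=
  foldl_replicate_unit _ n c

/-- `hasNbr` unfolded. [folklore] -/
theorem hasNbr_eq_true {n : ℕ} {v : List Bool} {c : List ℕ} {i a : ℕ} :
    hasNbr n v c i a = true ↔ ∃ j < n, adj n v i j = true ∧ col c j = a := by
  simp [hasNbr, List.any_eq_true]

/-- Values of a propagated list are old values or at most `2`. [folklore] -/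
theorem mem_propagate {n : ℕ} {v : List Bool} {c : List ℕ} {x : ℕ} (hx : x ∈ propagate n v c) :
    x ≤ 2 ∨ x ∈ c := by
  simp only [propagate, List.mem_map, List.mem_range] at hx
  obtain ⟨i, -, rfl⟩ := hx
  unfold recolour
  split_ifs
  · left; omega
  · left; omega
  · left; omega
  · unfold col
    rw [List.getD_eq_getElem?_getD]
    cases h : c[i]? with
    | none => left; simp
    | some y => right; simpa using List.mem_of_getElem? h

/-- Values of a seeded list are old values or `0`. [folklore] -/
theorem mem_seed {n s : ℕ} {c : List ℕ} {x : ℕ} (hx : x ∈ seed n s c) : x = 0 ∨ x ∈ c := by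
  simp only [seed, List.mem_map, List.mem_range] at hx
  obtain ⟨i, -, rfl⟩ := hx
  split_ifs
  · left; rfl
  · unfold col
    rw [List.getD_eq_getElem?_getD]
    cases h : c[i]? with
    | none => left; simp
    | some y => right; simpa using List.mem_of_getElem? h


/-! ### Size invariants of the scan (for the accumulator bounds of the folds) -/

/-- A fold that ignores its items is an iterate. [folklore] -/
theorem foldl_const_eq_iterate {α β : Type} (f : β → β) (l : List α) (b : β) :
    l.foldl (fun b _ => f b) b = f^[l.length] b := by
  induction l generalizing b with
  | nil => rfl
  | cons a l ih => rw [List.foldl_cons, ih, List.length_cons, Function.iterate_succ_apply]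

/-- Values along the propagation rounds are old values or at most `2`. [folklore] -/
theorem mem_iterate_propagate {n : ℕ} {v : List Bool} {c : List ℕ} {x : ℕ} :
    ∀ {k : ℕ}, x ∈ (propagate n v)^[k] c → x ≤ 2 ∨ x ∈ c
  | 0, h => Or.inr h
  | k + 1, h => by
    rw [Function.iterate_succ_apply'] at h
    rcases mem_propagate h with h | h
    · exact Or.inl h
    · exact mem_iterate_propagate h

/-- After at least one round the colour list has `n` items. [folklore] -/
theorem length_iterate_propagate {n : ℕ} (v : List Bool) (c : List ℕ) {k : ℕ} (hk : 0 < k) :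
    ((propagate n v)^[k] c).length = n := by
  obtain ⟨k, rfl⟩ := Nat.exists_eq_add_of_lt hk
  rw [Nat.zero_add, Function.iterate_succ_apply', length_propagate]

/-- The size invariant of the scan's accumulator: `n` items, all `≤ 2`. [folklore] -/
def SizeInv (n : ℕ) (c : List ℕ) : Prop := c.length = n ∧ ∀ x ∈ c, x ≤ 2

/-- The blank colouring satisfies the size invariant. [folklore] -/
theorem sizeInv_blank (n : ℕ) : SizeInv n (blank n) :=
  ⟨length_blank n, fun x hx => by
    simp only [blank, List.mem_map, List.mem_range] at hx
    obtain ⟨_, _, rfl⟩ := hx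
    exact le_rfl⟩

/-- One step of the scan keeps the size invariant. [folklore] -/
theorem sizeInv_step {n : ℕ} (v : List Bool) {c : List ℕ} (h : SizeInv n c) (s : ℕ) :
    SizeInv n (close n v (seed n s c)) := by
  have hseed : SizeInv n (seed n s c) :=
    ⟨length_seed n s c, fun x hx => by
      rcases mem_seed hx with rfl | hx
      · exact Nat.zero_le _
      · exact h.2 x hx⟩
  rw [close_eq_iterate]
  refine ⟨?_, fun x hx => ?_⟩
  · rcases Nat.eq_zero_or_pos n with hn | hn
    · subst hn
      simp [hseed.1]
    · exact length_iterate_propagate v _ hn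
  · rcases mem_iterate_propagate hx with hx | hx
    · exact hx
    · exact hseed.2 x hx

/-- The size invariant holds along the scan, for any list of seeds. [folklore] -/
theorem sizeInv_foldl {n : ℕ} (v : List Bool) :
    ∀ (l : List ℕ) {c : List ℕ}, SizeInv n c → SizeInv n (l.foldl (fun c s => close n v (seed n s c)) c)
  | [], _, h => h
  | s :: l, _, h => sizeInv_foldl v l (sizeInv_step v h s)

end TwoColouring

end Literature.Computability.Complexity
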